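import Summits.QuantumFields.BalabanUV.T4Continuum.Support.NE7K1LinTorusPairing
import Summits.QuantumFields.BalabanUV.T4Continuum.Support.NE7K1LinBlochDenominator

/-!
# NE7K1LinTorusSymbolBloch — row NE7 (node U5), candidate route HOM, path H1L, cell K1-lin(s): NEEDS-ESTIMATE #E1, B-E1 —
# THE IDENTIFICATION (lens 2's S-69-1 THEOREM I): the finite-torus symbol of the hard block-mean Schur complement IS the
# sample of the continuum block-mean multiplier, `σ₁(p) = n²·k_L(θ(p))`, and `σ_s(p) = n²[(1−s)Δ¹(θ) + s·k_L(θ)]` for all `s`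

Lineage `b2b-balaban-t4-ne7-p2` (CRUX PROVER NE7 #2), generation 75; file 59 (assembly part 2; part 1 = file 58
`NE7K1LinTorusPairing`).  Files 36–41 typed the finite-torus symbol
`σ_s(p) = torSymb hn M s y₀ p` of the doubled-torus two-cutoff line (eigenvalue on the plane wave `χ_p`, real, even, affine
in `s`, window, `σ_s(0) = 0`); files 47–48 typed the CONTINUUM multiplier `k_L = Δ^ξ_L ∕ 𝓝_L` and its zero-free strip.  File
47's docstring left ONE link untyped: «the identification of the finite-torus symbol with the samples of `k_L` (per-fibre
KKT)».  Lens 2 (t4-ne7-idea-2 g69, `t4/ideate/NE7/lens2-g69/IDENT-SUPPLY.md` = S-69-1, receipt N-69-1 at 8.6·10⁻¹⁴) located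
the proof on this lineage's names.  THIS FILE TYPES IT:

* (file 58: the abstract PAIRING IDENTITY `pairing_identity` — `MΦ = σ·χ_p∘blk` and block sums `L^{d+1}χ_p` force
  `1 = σ·Σ_k U_L(k;θ)∕m̂_k` —, and `torOpK_fibWave`: `m̂_k = n²·Δ^ξ_L(θ + 2πk) > 0`.)
* §1 THE KKT FIELD OF A COARSE WAVE: `torLineRep_one_apply` (`T^𝕋(1) = schurC (torB)`, file 30 `lineOpR_eq_schurC`),
  `schurC_mulVec_re ∕ _im` (the eigen-relation of file 37 in real parts), **`exists_kktWave`** (file 30's `kkt_field` +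
  `bsum_kktField` on `Re χ_p`, `Im χ_p`, recombined).
* §2 **THEOREM I `torSymb_one_eq_kLr`**: for EVERY dual index `p` with `|p_μ| < P_μ = 2nM_μ` (centred or raw representative;
  `p = 0` included) and every base point, `torSymb hn M 1 y₀ p = ↑(n²·kLr L θ(p))`, `θ(p)_μ = 2πp_μ∕P_μ`
  (`Nsymr_eq_DeltaXir_mul_aliasSum`: `𝓝_L = Δ^ξ_L·A_L` is file 47's DEFINITION regrouped); **COROLLARY `torSymb_eq_ofReal`**:
  `torSymb hn M s y₀ p = ↑(n²[(1−s)·Delta1r 0 θ(p) + s·kLr L θ(p)])` for every real `s` (files 41's `torSymb_affine ∕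
  torSymb_zero_re`); the centred and the raw forms `torSymb_one_eq_kLr_centred ∕ _boxDom`, and `abs_thetaOf_le_pi` (the centred
  momenta lie in file 47's zone `|θ_μ| ≤ π`, where `Nsymr_pos ∕ kLr_nonneg` apply).

So on every finite doubled torus the symbol of the two-cutoff torus line IS the sample, at the torus' dual momenta, of ONE
`L`-dependent, torus-INDEPENDENT multiplier `n²[(1−s)Δ¹ + s·k_L]` — the object whose strip regularity files 47–48 certify.

HONEST FRAMING: [folklore] finite Fourier analysis + this lineage's own KKT ∕ chart lemmas BY NAME (nearest in-tree result:
`King1986.EffectiveLaplacianSymbol.effSym_eq_inv`, King (4.5) for the SOFT, MASSIVE block-spin Laplacian on the `ZMod` torus;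
this is its hard, massless sibling for `schurC (torB)` in the chart normalisation `c = L^{−(d+1)}`); an IDENTITY — no bound,
no decay rate, no uniformity; R-E1 (the class-S re-typing of the strip engine for the `s`-family) untouched; nothing of
Bałaban's asserted; no `sorry`.  Census only (B-E1's docking link typed; #E1 OPEN = R-E1); NE7 NOT PRINTED ∕ NOT PROVED; spine
0∕9; FIXED FINITE T⁴, rung (B)+1; NOT infinite volume, NOT mass gap, NOT Clay.  HONEST DEPENDENCY: continuum YM on T⁴ ⇐
BetaPertH ∧ nine spine estimates (0/9 proved); BetaPertH ⇐ (D1) ∧ (D4) ∧ CAP+tail; G-an2-4 gates asym, D1 and NE2/3/4.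
-/

noncomputable section

open Finset Matrix Complex

namespace Summit.QuantumFields.BalabanUV.T4Continuum.NE7K1LinTorusSymbolBloch

open Literature.MathematicalPhysics.QuantumFieldTheory.Balaban1983to89
open Literature.MathematicalPhysics.QuantumFieldTheory.Balaban1983to89.B4Reflection242
open Literature.MathematicalPhysics.QuantumFieldTheory.Balaban1983to89.B4Lower18
open Literature.MathematicalPhysics.QuantumFieldTheory.Balaban1983to89.B4Green244 (finePt)
open Literature.MathematicalPhysics.QuantumFieldTheory.Balaban1983to89.B4TorusPositivity (wrap)
open Literature.MathematicalPhysics.QuantumFieldTheory.Balaban1983to89.B4Strip (S1r Sxir uFactorr Ur shiftr DeltaXir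
  Delta1r Sxir_nonneg)
open NE7K1LinFoldKernels NE7K1LinFoldMatrices NE7K1LinSchurFold NE7K1LinTorusChart NE7K1LinSchurFoldBox NE7K1LinBlockCoords
open NE7K1LinTorusLineSymbol NE7K1LinTorusSymbolReal NE7K1LinTorusFloor NE7K1LinTorusSymbolWindow
open NE7K1LinTorusFineWaves NE7K1LinTorusFineWavesFibre NE7K1LinBlochDenominator NE7K1LinSchurLineU1 NE7K1LinTorusPairing

variable {d : ℕ}

/-! ### §1 The KKT field of a coarse plane wave -/

section KKT

variable {n L : ℕ} [NeZero L] {M : Fin (d + 1) → ℕ}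

omit [NeZero L] in
/-- `(Sᵀ V)(x) = V(blk x)`: the transpose of the block-sum matrix is block-constant extension. [folklore] -/
theorem bsum_transpose_mulVec (b : ℕ) (R : Finset (Fin (d + 1) → ℤ)) (V : ↥(R.image (blk b)) → ℝ) (x : ↥R) :
    ((bsum b R)ᵀ *ᵥ V) x = V (rblk b R x) := by
  classical
  simp only [Matrix.mulVec, dotProduct, Matrix.transpose_apply, bsum_apply, ite_mul, one_mul, zero_mul]
  rw [Finset.sum_ite_eq, if_pos (Finset.mem_univ _)]

/-- block sums as chart sums: `(S w)(β) = Σ_j w(rchart β j)`. [folklore] -/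
theorem bsum_mulVec_eq_sum_chart {T : Finset (Fin (d + 1) → ℤ)} (hTL : IsBlockUnion L T) (w : ↥T → ℝ)
    (β : ↥(T.image (blk L))) :
    (bsum L T *ᵥ w) β = ∑ j : Fin (d + 1) → Fin L, w (rchart NeZero.one_le hTL β j) := by
  classical
  rw [bsum_mulVec, filter_rblk_eq_image NeZero.one_le hTL β,
    Finset.sum_image fun j _ j' _ h => rchart_injective NeZero.one_le hTL β h]

/-- **`T^𝕋(1) = schurC (torB)`**: at `s = 1` the transported torus line is the hard block-mean Schur complement of run B's
torus chart operator (file 30's `lineOpR_eq_schurC`). [folklore] -/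
theorem torLineRep_one_apply (hn : 1 ≤ n) (M : Fin (d + 1) → ℕ) (x y : ↥(boxDom (dbl fun i => n * M i))) :
    torLineRep (L := L) hn M 1 x y =
      schurC (torB (isBlockUnion_fine (fineTor_isBlockUnion hn (NeZero.one_le : 1 ≤ L) M)) n 0 (fun i => n * L * M i))
        ⟨x.1, mem_image_of_mem_dbl (L := L) x.2⟩ ⟨y.1, mem_image_of_mem_dbl (L := L) y.2⟩ := by
  unfold torLineRep torLine
  rw [lineOpR_eq_schurC, Matrix.add_apply, Matrix.smul_apply, Matrix.smul_apply, sub_self, zero_smul, one_smul,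
    zero_add]

/-- the eigen-relation of file 37 at `s = 1`, on the label set of the fine torus:
`Σ_y schurC(x, y)·χ_p(y) = σ₁(p)·χ_p(x)`. [folklore] -/
theorem schurC_planeWave (hn : 1 ≤ n) (hM : ∀ i, 1 ≤ M i) (y₀ : ↥(boxDom (dbl fun i => n * M i)))
    (p : Fin (d + 1) → ℤ) (x : ↥((boxDom (dbl fun i => n * L * M i)).image (blk L))) :
    ∑ y : ↥((boxDom (dbl fun i => n * L * M i)).image (blk L)),
        ((schurC (torB (isBlockUnion_fine (fineTor_isBlockUnion hn (NeZero.one_le : 1 ≤ L) M)) n 0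
          (fun i => n * L * M i)) x y : ℝ) : ℂ) * chiT (dbl fun i => n * M i) p y.1 =
      torSymb (L := L) hn M 1 y₀ p * chiT (dbl fun i => n * M i) p x.1 := by
  have h := torLine_zero_planeWave (L := L) hn hM 1 y₀ ⟨x.1, mem_dbl_of_mem_image x.2⟩ p
  rw [← h]
  symm
  refine Fintype.sum_equiv ⟨fun y => ⟨y.1, mem_image_of_mem_dbl (L := L) y.2⟩,
    fun y => ⟨y.1, mem_dbl_of_mem_image y.2⟩, fun y => Subtype.ext rfl, fun y => Subtype.ext rfl⟩ _ _ fun y => ?_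
  simp only [Equiv.coe_fn_mk]
  rw [torLineRep_one_apply]

/-- the eigen-relation in real parts: `schurC · Re χ_p = σ₁(p)·Re χ_p` (`σ₁` is real, file 38). [folklore] -/
theorem schurC_mulVec_re (hn : 1 ≤ n) (hM : ∀ i, 1 ≤ M i) (y₀ : ↥(boxDom (dbl fun i => n * M i)))
    (p : Fin (d + 1) → ℤ) :
    schurC (torB (isBlockUnion_fine (fineTor_isBlockUnion hn (NeZero.one_le : 1 ≤ L) M)) n 0 (fun i => n * L * M i)) *ᵥ
        (fun y => (chiT (dbl fun i => n * M i) p y.1).re) =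
      (torSymb (L := L) hn M 1 y₀ p).re • (fun y => (chiT (dbl fun i => n * M i) p y.1).re) := by
  ext x
  have h := congrArg Complex.re (schurC_planeWave hn hM y₀ p x)
  rw [Complex.re_sum, Complex.mul_re, torSymb_im_eq_zero hn hM 1 y₀ p, zero_mul, sub_zero] at h
  simp_rw [Complex.re_ofReal_mul] at h
  simpa [Matrix.mulVec, dotProduct] using h

/-- the eigen-relation in imaginary parts: `schurC · Im χ_p = σ₁(p)·Im χ_p`. [folklore] -/
theorem schurC_mulVec_im (hn : 1 ≤ n) (hM : ∀ i, 1 ≤ M i) (y₀ : ↥(boxDom (dbl fun i => n * M i)))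
    (p : Fin (d + 1) → ℤ) :
    schurC (torB (isBlockUnion_fine (fineTor_isBlockUnion hn (NeZero.one_le : 1 ≤ L) M)) n 0 (fun i => n * L * M i)) *ᵥ
        (fun y => (chiT (dbl fun i => n * M i) p y.1).im) =
      (torSymb (L := L) hn M 1 y₀ p).re • (fun y => (chiT (dbl fun i => n * M i) p y.1).im) := by
  ext x
  have h := congrArg Complex.im (schurC_planeWave hn hM y₀ p x)
  rw [Complex.im_sum, Complex.mul_im, torSymb_im_eq_zero hn hM 1 y₀ p, zero_mul, add_zero] at h
  simp_rw [Complex.im_ofReal_mul] at h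
  simpa [Matrix.mulVec, dotProduct] using h

/-- **THE KKT FIELD OF A COARSE PLANE WAVE** (EXISTENCE side of file 30's KKT system, `kkt_field` + `bsum_kktField` on
`Re χ_p` and `Im χ_p`, recombined): a complex fine field `Φ` with `M_f Φ = σ₁(p)·χ_p∘blk` and block sums `L^{d+1}·χ_p`.
[folklore] -/
theorem exists_kktWave (hn : 1 ≤ n) (hM : ∀ i, 1 ≤ M i) (y₀ : ↥(boxDom (dbl fun i => n * M i)))
    (p : Fin (d + 1) → ℤ) :
    ∃ Φ : ↥(boxDom (dbl fun i => n * L * M i)) → ℂ,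
      (∀ x : ↥(boxDom (dbl fun i => n * L * M i)),
        ∑ x' : ↥(boxDom (dbl fun i => n * L * M i)),
          ((torOpK (n * L) 0 (fun i => n * L * M i) (boxDom (dbl fun i => n * L * M i)) x x' : ℝ) : ℂ) * Φ x' =
            ((torSymb (L := L) hn M 1 y₀ p).re : ℂ) *
              chiT (dbl fun i => n * M i) p (rblk L (boxDom (dbl fun i => n * L * M i)) x).1) ∧
      (∀ β : ↥((boxDom (dbl fun i => n * L * M i)).image (blk L)),
        ∑ j : Fin (d + 1) → Fin L, Φ (rchart NeZero.one_le (isBlockUnion_fine (fineTor_isBlockUnion hn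
          (NeZero.one_le : 1 ≤ L) M)) β j) = (L : ℂ) ^ (d + 1) * chiT (dbl fun i => n * M i) p β.1) := by
  classical
  have hL : 1 ≤ L := NeZero.one_le
  have hT' : IsBlockUnion (n * L) (boxDom (dbl fun i => n * L * M i)) := fineTor_isBlockUnion hn hL M
  have hN : ∀ i, 1 ≤ (fun i => n * L * M i) i := fine_pos hn hL hM
  set T := boxDom (dbl fun i => n * L * M i) with hT
  set Mf := torOpK (n * L) 0 (fun i => n * L * M i) T with hMf
  set B := coordT (isBlockUnion_fine hT') with hB
  set S := bsum L T with hS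
  set ℓ : ℝ := (L : ℝ) ^ (d + 1) with hℓ
  set c : ℝ := ((L : ℝ) ^ (d + 1))⁻¹ with hc
  have hℓ0 : ℓ ≠ 0 := pow_ne_zero _ (by exact_mod_cast NeZero.ne L)
  have hST : ∀ u, S *ᵥ (B *ᵥ u) = fun β => ℓ * u (Sum.inl β) := bsum_coordT (isBlockUnion_fine hT')
  have hTs := coordT_surj (isBlockUnion_fine hT')
  have hD : IsUnit ((chartOp c B Mf).toBlocks₂₂).det := isUnit_det_torB_fluct hn hT' rfl hN le_rfl
  set σ := torSymb (L := L) hn M 1 y₀ p with hσ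
  set V₁ : ↥(T.image (blk L)) → ℝ := fun y => (chiT (dbl fun i => n * M i) p y.1).re with hV₁
  set V₂ : ↥(T.image (blk L)) → ℝ := fun y => (chiT (dbl fun i => n * M i) p y.1).im with hV₂
  have hSV₁ : schurC (chartOp c B Mf) *ᵥ V₁ = σ.re • V₁ := schurC_mulVec_re hn hM y₀ p
  have hSV₂ : schurC (chartOp c B Mf) *ᵥ V₂ = σ.re • V₂ := schurC_mulVec_im hn hM y₀ p
  set Φ₁ := kktField c B Mf V₁ with hΦ₁
  set Φ₂ := kktField c B Mf V₂ with hΦ₂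
  -- entries of `M_f Φ_j` and block sums of `Φ_j`
  have hMj : ∀ (V : ↥(T.image (blk L)) → ℝ), schurC (chartOp c B Mf) *ᵥ V = σ.re • V →
      ∀ x : ↥T, (Mf *ᵥ kktField c B Mf V) x = σ.re * V (rblk L T x) := by
    intro V hV x
    have h := congrFun (kkt_field hST hTs hℓ0 hD V) x
    rw [hV] at h
    simp only [Pi.smul_apply, smul_eq_mul, Matrix.mulVec_smul] at h
    rw [bsum_transpose_mulVec] at h
    exact mul_left_cancel₀ (inv_ne_zero hℓ0) h
  have hSj : ∀ (V : ↥(T.image (blk L)) → ℝ) (β : ↥(T.image (blk L))),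
      ∑ j : Fin (d + 1) → Fin L, kktField c B Mf V (rchart NeZero.one_le (isBlockUnion_fine hT') β j) = ℓ * V β := by
    intro V β
    have h := congrFun (bsum_kktField (c := c) (M := Mf) hST V) β
    rw [bsum_mulVec_eq_sum_chart (isBlockUnion_fine hT')] at h
    simpa using h
  refine ⟨fun x => (Φ₁ x : ℂ) + (Φ₂ x : ℂ) * Complex.I, fun x => ?_, fun β => ?_⟩
  · have e : ∀ x' : ↥T, (Mf x x' : ℂ) * ((Φ₁ x' : ℂ) + (Φ₂ x' : ℂ) * Complex.I) =
        ((Mf x x' * Φ₁ x' : ℝ) : ℂ) + ((Mf x x' * Φ₂ x' : ℝ) : ℂ) * Complex.I := by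
      intro x'; push_cast; ring
    simp_rw [e]
    rw [Finset.sum_add_distrib, ← Finset.sum_mul, ← Complex.ofReal_sum, ← Complex.ofReal_sum]
    have h1 : ∑ x' : ↥T, Mf x x' * Φ₁ x' = σ.re * V₁ (rblk L T x) := hMj V₁ hSV₁ x
    have h2 : ∑ x' : ↥T, Mf x x' * Φ₂ x' = σ.re * V₂ (rblk L T x) := hMj V₂ hSV₂ x
    rw [h1, h2, hV₁, hV₂]
    conv_rhs => rw [← Complex.re_add_im (chiT (dbl fun i => n * M i) p (rblk L T x).1)]
    push_cast
    ring
  · have hb1 : ∑ j : Fin (d + 1) → Fin L, Φ₁ (rchart NeZero.one_le (isBlockUnion_fine hT') β j) = ℓ * V₁ β :=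
      hSj V₁ β
    have hb2 : ∑ j : Fin (d + 1) → Fin L, Φ₂ (rchart NeZero.one_le (isBlockUnion_fine hT') β j) = ℓ * V₂ β :=
      hSj V₂ β
    show ∑ j : Fin (d + 1) → Fin L, ((Φ₁ (rchart NeZero.one_le (isBlockUnion_fine hT') β j) : ℂ) +
      (Φ₂ (rchart NeZero.one_le (isBlockUnion_fine hT') β j) : ℂ) * Complex.I) = _
    rw [Finset.sum_add_distrib, ← Finset.sum_mul, ← Complex.ofReal_sum, ← Complex.ofReal_sum, hb1, hb2, hV₁, hV₂, hℓ]
    conv_rhs => rw [← Complex.re_add_im (chiT (dbl fun i => n * M i) p β.1)]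
    push_cast
    ring

end KKT

/-! ### §2 THEOREM I and its corollaries -/

section Main

variable {n L : ℕ} [NeZero L] {M : Fin (d + 1) → ℕ}

/-- **`𝓝_L = Δ^ξ_L·A_L`**: file 47's regrouped denominator against the alias sum `A_L(θ) = Σ_k U_L(k;θ)∕Δ^ξ_L(θ + 2πk)`
(where `Δ^ξ_L(θ) ≠ 0`). [folklore] -/
theorem Nsymr_eq_DeltaXir_mul_aliasSum (L : ℕ) [NeZero L] (θ : Fin (d + 1) → ℝ) (hΔ : DeltaXir L 0 θ ≠ 0) :
    Nsymr L θ = DeltaXir L 0 θ * ∑ k : Fin (d + 1) → Fin L, Ur L k θ / DeltaXir L 0 (shiftr L k θ) := by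
  classical
  rw [Nsymr, Finset.mul_sum, ← Finset.add_sum_erase _ _ (Finset.mem_univ (fun _ => (0 : Fin L)))]
  congr 1
  · have h0 : shiftr L (fun _ => (0 : Fin L)) θ = θ := by funext μ; simp [shiftr]
    rw [h0, ← mul_div_assoc, mul_div_cancel_left₀ _ hΔ]
  · exact Finset.sum_congr rfl fun k _ => by ring

/-- `Δ^ξ_L(θ(p)) ≠ 0` for `p ≠ 0`, `|p_μ| < P_μ`. [folklore] -/
theorem DeltaXir_thetaOf_ne_zero {Pc : Fin (d + 1) → ℕ} (hPc : ∀ i, 1 ≤ Pc i) {p : Fin (d + 1) → ℤ}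
    (hp : ∀ μ, |p μ| < Pc μ) (hp0 : p ≠ 0) : DeltaXir L 0 (thetaOf Pc p) ≠ 0 := by
  have h := DeltaXir_shiftr_pos (L := L) hPc hp hp0 (fun _ => (0 : Fin L))
  have h0 : shiftr L (fun _ => (0 : Fin L)) (thetaOf Pc p) = thetaOf Pc p := by funext μ; simp [shiftr]
  rw [h0] at h
  exact h.ne'

/-- **THEOREM I (lens 2's S-69-1, the identification): `σ₁(p) = n²·k_L(θ(p))`.**  For every mesh `n ≥ 1`, blocking factor
`L ≥ 1`, torus `M`, base point `y₀` and EVERY dual index `p` with `|p_μ| < P_μ = 2nM_μ` (centred or raw representative,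
`p = 0` included): the symbol of the hard block-mean Schur complement of the doubled-torus line at `p` is `n²` times file 47's
continuum multiplier `kLr L` at the coarse-unit momentum `θ(p)_μ = 2πp_μ∕P_μ`. [folklore] -/
theorem torSymb_one_eq_kLr (hn : 1 ≤ n) (hM : ∀ i, 1 ≤ M i) (y₀ : ↥(boxDom (dbl fun i => n * M i)))
    {p : Fin (d + 1) → ℤ} (hp : ∀ μ, |p μ| < (dbl (fun i => n * M i) μ : ℤ)) :
    torSymb (L := L) hn M 1 y₀ p = (((n : ℝ) ^ 2 * kLr L (thetaOf (dbl fun i => n * M i) p) : ℝ) : ℂ) := by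
  classical
  have hL : 1 ≤ L := NeZero.one_le
  have hPc : ∀ i, 1 ≤ dbl (fun i => n * M i) i := dbl_pos (mul_pos_side hn hM)
  have hσim := torSymb_im_eq_zero (L := L) hn hM 1 y₀ p
  by_cases hp0 : p = 0
  · subst hp0
    rw [torSymb_at_zero hn hM 1 y₀]
    have hθ : thetaOf (dbl fun i => n * M i) (0 : Fin (d + 1) → ℤ) = fun _ => 0 := by
      funext μ; simp [thetaOf]
    rw [hθ, kLr]
    simp [DeltaXir, Sxir]
  · obtain ⟨Φ, hMΦ, hSΦ⟩ := exists_kktWave (L := L) hn hM y₀ p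
    set θ := thetaOf (dbl fun i => n * M i) p with hθ
    have hn0 : (n : ℝ) ≠ 0 := by exact_mod_cast (show n ≠ 0 by omega)
    have hmhat : ∀ k : Fin (d + 1) → Fin L, (n : ℝ) ^ 2 * DeltaXir L 0 (shiftr L k θ) ≠ 0 := fun k =>
      mul_ne_zero (pow_ne_zero _ hn0) (DeltaXir_shiftr_pos hPc hp hp0 k).ne'
    have hT0 : 0 < Fintype.card ↥((boxDom (dbl fun i => n * L * M i)).image (blk L)) :=
      Fintype.card_pos_iff.2 ⟨⟨y₀.1, mem_image_of_mem_dbl (L := L) y₀.2⟩⟩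
    have key := pairing_identity (L := L) (Pc := dbl fun i => n * M i) (dbl_fine_eq n L M) hPc (isBlockUnion_fine (fineTor_isBlockUnion hn hL M)) hT0 hp
      (torOpK (n * L) 0 (fun i => n * L * M i) _) (torOpK_isSymm (n * L) 0 _ rfl)
      (fun k => (n : ℝ) ^ 2 * DeltaXir L 0 (shiftr L k θ)) hmhat (fun k x => torOpK_fibWave hn hM p k x) Φ
      (torSymb (L := L) hn M 1 y₀ p).re hMΦ hSΦ
    -- `key : 1 = σ.re · Σ_k U_L(k;θ) ∕ (n²·Δ^ξ_L(θ+2πk))`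
    have hΔ0 : DeltaXir L 0 θ ≠ 0 := DeltaXir_thetaOf_ne_zero hPc hp hp0
    set A := ∑ k : Fin (d + 1) → Fin L, Ur L k θ / DeltaXir L 0 (shiftr L k θ) with hA
    have hsum : ∑ k : Fin (d + 1) → Fin L, Ur L k θ / ((n : ℝ) ^ 2 * DeltaXir L 0 (shiftr L k θ)) =
        A / (n : ℝ) ^ 2 := by
      rw [hA, Finset.sum_div]
      refine Finset.sum_congr rfl fun k _ => ?_
      rw [div_div, mul_comm]
    rw [hsum] at key
    have hA0 : A ≠ 0 := by
      intro hA0; rw [hA0, zero_div, mul_zero] at key; exact one_ne_zero key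
    have hσ : (torSymb (L := L) hn M 1 y₀ p).re = (n : ℝ) ^ 2 / A := by
      rw [eq_div_iff hA0]
      have hn2 : (n : ℝ) ^ 2 ≠ 0 := pow_ne_zero _ hn0
      field_simp at key
      linarith
    have hk : kLr L θ = 1 / A := by
      rw [kLr, Nsymr_eq_DeltaXir_mul_aliasSum L θ hΔ0, ← hA]
      field_simp
    apply Complex.ext
    · rw [Complex.ofReal_re, hk, hσ]; ring
    · rw [Complex.ofReal_im, hσim]

/-- THEOREM I, real part. [folklore] -/
theorem torSymb_one_re_eq_kLr (hn : 1 ≤ n) (hM : ∀ i, 1 ≤ M i) (y₀ : ↥(boxDom (dbl fun i => n * M i)))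
    {p : Fin (d + 1) → ℤ} (hp : ∀ μ, |p μ| < (dbl (fun i => n * M i) μ : ℤ)) :
    (torSymb (L := L) hn M 1 y₀ p).re = (n : ℝ) ^ 2 * kLr L (thetaOf (dbl fun i => n * M i) p) := by
  rw [torSymb_one_eq_kLr hn hM y₀ hp, Complex.ofReal_re]

/-- `σ_0(p) = n²·Δ¹(θ(p))` as a complex number (files 40∕41's `torSymb_zero_re` + file 38's reality). [folklore] -/
theorem torSymb_zero_eq_Delta1r (hn : 1 ≤ n) (hM : ∀ i, 1 ≤ M i) (y₀ : ↥(boxDom (dbl fun i => n * M i)))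
    (p : Fin (d + 1) → ℤ) :
    torSymb (L := L) hn M 0 y₀ p = (((n : ℝ) ^ 2 * Delta1r 0 (thetaOf (dbl fun i => n * M i) p) : ℝ) : ℂ) := by
  apply Complex.ext
  · rw [torSymb_zero_re hn hM y₀ p, Complex.ofReal_re, Delta1r, add_zero]
    rfl
  · rw [torSymb_im_eq_zero hn hM 0 y₀ p, Complex.ofReal_im]

/-- **COROLLARY (all `s`): `σ_s(p) = n²·[(1−s)·Δ¹(θ(p)) + s·k_L(θ(p))]`** — on every finite doubled torus the symbol of the
two-cutoff torus line is the sample at the dual momenta of ONE `L`-dependent, torus-INDEPENDENT multiplier (file 41's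
`torSymb_affine`). [folklore] -/
theorem torSymb_eq_ofReal (hn : 1 ≤ n) (hM : ∀ i, 1 ≤ M i) (y₀ : ↥(boxDom (dbl fun i => n * M i)))
    {p : Fin (d + 1) → ℤ} (hp : ∀ μ, |p μ| < (dbl (fun i => n * M i) μ : ℤ)) (s : ℝ) :
    torSymb (L := L) hn M s y₀ p = (((n : ℝ) ^ 2 * ((1 - s) * Delta1r 0 (thetaOf (dbl fun i => n * M i) p) +
      s * kLr L (thetaOf (dbl fun i => n * M i) p)) : ℝ) : ℂ) := by
  rw [torSymb_affine hn M s y₀ p, torSymb_one_eq_kLr hn hM y₀ hp, torSymb_zero_eq_Delta1r hn hM y₀ p]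
  push_cast
  ring

/-- COROLLARY, real part. [folklore] -/
theorem torSymb_re_eq (hn : 1 ≤ n) (hM : ∀ i, 1 ≤ M i) (y₀ : ↥(boxDom (dbl fun i => n * M i)))
    {p : Fin (d + 1) → ℤ} (hp : ∀ μ, |p μ| < (dbl (fun i => n * M i) μ : ℤ)) (s : ℝ) :
    (torSymb (L := L) hn M s y₀ p).re = (n : ℝ) ^ 2 * ((1 - s) * Delta1r 0 (thetaOf (dbl fun i => n * M i) p) +
      s * kLr L (thetaOf (dbl fun i => n * M i) p)) := by
  rw [torSymb_eq_ofReal hn hM y₀ hp s, Complex.ofReal_re]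

/-- THEOREM I for the RAW representative `p ∈ boxDom P` (`0 ≤ p_μ < P_μ`). [folklore] -/
theorem torSymb_one_eq_kLr_boxDom (hn : 1 ≤ n) (hM : ∀ i, 1 ≤ M i) (y₀ : ↥(boxDom (dbl fun i => n * M i)))
    {p : Fin (d + 1) → ℤ} (hp : p ∈ boxDom (dbl fun i => n * M i)) :
    torSymb (L := L) hn M 1 y₀ p = (((n : ℝ) ^ 2 * kLr L (thetaOf (dbl fun i => n * M i) p) : ℝ) : ℂ) :=
  torSymb_one_eq_kLr hn hM y₀ fun μ => by
    have h := (mem_boxDom.1 hp) μ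
    rw [abs_lt]; constructor <;> linarith [h.1, h.2]

/-- THEOREM I for the CENTRED representative `2|p_μ| ≤ P_μ` (lens 2's recommended zone). [folklore] -/
theorem torSymb_one_eq_kLr_centred (hn : 1 ≤ n) (hM : ∀ i, 1 ≤ M i) (y₀ : ↥(boxDom (dbl fun i => n * M i)))
    {p : Fin (d + 1) → ℤ} (hp : ∀ μ, 2 * |p μ| ≤ (dbl (fun i => n * M i) μ : ℤ)) :
    torSymb (L := L) hn M 1 y₀ p = (((n : ℝ) ^ 2 * kLr L (thetaOf (dbl fun i => n * M i) p) : ℝ) : ℂ) :=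
  torSymb_one_eq_kLr hn hM y₀ fun μ => by
    have h := hp μ
    have hP : (1 : ℤ) ≤ (dbl (fun i => n * M i) μ : ℤ) := by exact_mod_cast dbl_pos (mul_pos_side hn hM) μ
    have h0 := abs_nonneg (p μ)
    linarith

omit [NeZero L] in
/-- the centred momenta lie in the Brillouin zone `|θ(p)_μ| ≤ π` (where file 47's `Nsymr_pos ∕ kLr_nonneg` apply).
[folklore] -/
theorem abs_thetaOf_le_pi {Pc : Fin (d + 1) → ℕ} (hPc : ∀ i, 1 ≤ Pc i) {p : Fin (d + 1) → ℤ}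
    (hp : ∀ μ, 2 * |p μ| ≤ (Pc μ : ℤ)) (μ : Fin (d + 1)) : |thetaOf Pc p μ| ≤ Real.pi := by
  have hP0 : (0 : ℝ) < Pc μ := by exact_mod_cast hPc μ
  have h : 2 * |(p μ : ℝ)| ≤ (Pc μ : ℝ) := by exact_mod_cast hp μ
  rw [thetaOf, abs_div, abs_of_pos hP0, div_le_iff₀ hP0, abs_mul, abs_of_pos (by positivity : (0 : ℝ) < 2 * Real.pi)]
  nlinarith [Real.pi_pos]

/-- hence `σ₁(p) ≥ 0`-compatible reading: on the centred zone THEOREM I's right side is `n²·kLr` with `kLr ≥ 0`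
(file 47 `kLr_nonneg`). [folklore] -/
theorem torSymb_one_re_nonneg_centred (hn : 1 ≤ n) (hM : ∀ i, 1 ≤ M i) (y₀ : ↥(boxDom (dbl fun i => n * M i)))
    {p : Fin (d + 1) → ℤ} (hp : ∀ μ, 2 * |p μ| ≤ (dbl (fun i => n * M i) μ : ℤ)) :
    0 ≤ (torSymb (L := L) hn M 1 y₀ p).re := by
  rw [torSymb_one_eq_kLr_centred hn hM y₀ hp, Complex.ofReal_re]
  exact mul_nonneg (by positivity)
    (kLr_nonneg L NeZero.one_le _ (abs_thetaOf_le_pi (dbl_pos (mul_pos_side hn hM)) hp))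

end Main

end Summit.QuantumFields.BalabanUV.T4Continuum.NE7K1LinTorusSymbolBloch

end
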